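import Summits.BirchSwinnertonDyer.BirchSwinnertonDyer.Theorems.AdditiveBranchIMCGordTwoTwistedWanDefs
import HarnessLib

/-!
# Route `AdditiveBranchIMC`, crux `GordTwoRankZeroOffCaseOne` (19357) / `GordTwoRankOne` (19358): the VOCABULARY of door C of LeadReport26 §4 —
# «a LOOSE twisted Wan prime» (`p ∣ v_{ℓ₀}(j)` allowed; the Skinner–Urban prime taken elsewhere) — under the Theorems import fence
# (definitions and two projections; nothing asserted; LEAD cruxlead-19357 g18)

`TwistedWanRoad.TwistedWanPrime W p ℓ` (p797236, `AdditiveBranchIMCGordTwoTwistedWanDefs.lean`) bundles Skinner–Urban's ramification clause in the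
model-free form `p ∤ v_ℓ(j)`, and `TameRoadFieldTwisted W p ℓ K` bundles `TwistedWanPrime`; every file of FIELD 1 and of FieldTwoTwisted design D2 takes
`TameRoadFieldTwisted` as its field hypothesis. The clause is consumed at exactly two places of the landed kernel (LeadReport27 §4.2): the Tamagawa
transport to `E^{(d_K)}` (replaceable — `E^{(d_K)}` is NON-split multiplicative at `ℓ`, so `c_ℓ ∈ {1, 2}`) and the Skinner–Urban prime of the partner
`A` in design D2 (replaceable by any multiplicative prime `r` of `E` with `p ∤ v_r(Δ_min)`: `A ≅ E` over `ℚ_r`). The pen's e19 census (LeadReport26 §3)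
counts 62 r₀ / 61 r₁ E3′ rows all of whose odd twisted Wan candidates are LOOSE. To re-key the chain to such rows the field hypothesis must drop the
clause; these are its names:

* `TwistedWanPrimeLoose W p ℓ` — `TwistedWanPrime W p ℓ` minus `p ∤ v_ℓ(j)`: `ℓ ≠ p` odd, `E` additive at `ℓ`, `W₁ = E^{(ℓ*)}` multiplicative at `ℓ`;
* `TameRoadFieldTwistedLoose W p ℓ K` — `TameRoadFieldTwisted` with `TwistedWanPrimeLoose` in place of `TwistedWanPrime` (all other clauses verbatim);
* `twistedWanPrimeLoose_of_twistedWanPrime`, `tameRoadFieldTwistedLoose_of_tameRoadFieldTwisted` — the projections.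

HONEST FRAMING: definitions and two projections; no named fact, nothing booked; 19357 / 19358 stay OPEN; BSD is proved for no curve. A prover does not file
statement items (D-0014). References: [SkinnerUrban2014] Thm. 3.6.4 (the ramification clause); [JetchevSkinnerWan2017] §7.4.1.
-/

set_option autoImplicit false
set_option linter.dupNamespace false

noncomputable section

open scoped Classical

open NumberField IsDedekindDomain IsDedekindDomain.HeightOneSpectrum Rat.HeightOneSpectrum
open WeierstrassCurve Literature.NumberTheory.EllipticCurves
  Literature.NumberTheory.EllipticCurves.Rank1Residual
open Summit.BirchSwinnertonDyer.Rank1Residual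
open Summit.BirchSwinnertonDyer.BirchSwinnertonDyer.Theorems

namespace Summit.BirchSwinnertonDyer.BirchSwinnertonDyer.Theorems.TwistedWanRoad

/-- A LOOSE E3′ WAN PRIME: an ODD prime `ℓ ≠ p` at which `E` (globally minimal `W`) is ADDITIVE, of quadratic-twist type AND POTENTIALLY
MULTIPLICATIVE — `W₁ := E^{(ℓ*)}` has multiplicative reduction at `ℓ` —; `TwistedWanPrime W p ℓ` WITHOUT Skinner–Urban's clause `p ∤ v_ℓ(j)`.
[predicate; nothing asserted] -/
def TwistedWanPrimeLoose (W : WeierstrassCurve ℚ) [W.IsElliptic] (p ℓ : ℕ) [hℓ : Fact ℓ.Prime] : Prop :=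
  ℓ ≠ p ∧ ℓ ≠ 2 ∧ W.HasAdditiveReductionAt ((primesEquiv (R := ℤ)).symm ⟨ℓ, hℓ.out⟩) ∧
    (W.quadraticTwist ((primeStar ℓ : ℤ) : ℚ)).HasMultiplicativeReductionAtPrime ℓ

/-- THE E3′ ROAD FIELD AT A LOOSE TWISTED WAN PRIME: `K` imaginary quadratic with `d_K < −4`, the loose twisted Wan prime `ℓ` RAMIFIED in `K` IN THE
NON-SPLIT CLASS, every other prime of `N_E` split, `2` split if `2 ∤ N_E`, `p` split or ramified — `TameRoadFieldTwisted` with `TwistedWanPrimeLoose`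
in place of `TwistedWanPrime`. [predicate; nothing asserted] -/
def TameRoadFieldTwistedLoose (W : WeierstrassCurve ℚ) [W.IsElliptic] [W.IsGloballyMinimal] (p ℓ : ℕ) [Fact ℓ.Prime]
    (K : Type) [Field K] [NumberField K] : Prop :=
  IsImaginaryQuadratic K ∧ NumberField.discr K < -4 ∧ TwistedWanPrimeLoose W p ℓ ∧ NonsplitClassAt W ℓ K ∧
    (∀ r : ℕ, r.Prime → r ∣ W.conductorNorm ℤ → r ≠ ℓ → ((Ideal.span {(r : ℤ)}).primesOver (𝓞 K)).ncard = 2) ∧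
    (¬ 2 ∣ W.conductorNorm ℤ → ((Ideal.span {(2 : ℤ)}).primesOver (𝓞 K)).ncard = 2) ∧
    SatisfiesHeegnerHypothesis p K

/-- A twisted Wan prime is a loose twisted Wan prime (forget Skinner–Urban's clause). [folklore] -/
theorem twistedWanPrimeLoose_of_twistedWanPrime {W : WeierstrassCurve ℚ} [W.IsElliptic] {p ℓ : ℕ} [Fact ℓ.Prime]
    (h : TwistedWanPrime W p ℓ) : TwistedWanPrimeLoose W p ℓ :=
  ⟨h.1, h.2.1, h.2.2.1, h.2.2.2.1⟩

/-- A twisted road field is a loose twisted road field (forget Skinner–Urban's clause). [folklore] -/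
theorem tameRoadFieldTwistedLoose_of_tameRoadFieldTwisted {W : WeierstrassCurve ℚ} [W.IsElliptic] [W.IsGloballyMinimal] {p ℓ : ℕ}
    [Fact ℓ.Prime] {K : Type} [Field K] [NumberField K] (h : TameRoadFieldTwisted W p ℓ K) : TameRoadFieldTwistedLoose W p ℓ K :=
  ⟨h.1, h.2.1, twistedWanPrimeLoose_of_twistedWanPrime h.2.2.1, h.2.2.2.1, h.2.2.2.2.1, h.2.2.2.2.2.1, h.2.2.2.2.2.2⟩

end Summit.BirchSwinnertonDyer.BirchSwinnertonDyer.Theorems.TwistedWanRoad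

end
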